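import Mathlib.Analysis.InnerProductSpace.GramSchmidtOrtho
import HarnessLib

/-!
# Gram–Schmidt on an almost orthonormal frame moves it little (quantitative stability)

Topic `Literature/Analysis/InnerProduct`. If `F₁, …, Fₙ` are vectors of a real inner product
space whose Gram matrix is `δ`-close to the identity, `|⟪Fᵢ, Fⱼ⟫ - δᵢⱼ| ≤ δ` with
`δ · (8(n+1))ⁿ ≤ 1/4`, then the Gram–Schmidt orthonormalisation `b = gramSchmidtNormed ℝ F`
(Mathlib) is an orthonormal frame with `‖bᵢ - Fᵢ‖ ≤ 3 (8(n+1))ⁿ δ` and `⟪bᵢ, Fᵢ⟫ > 0`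
(`gramSchmidtNormed_sub_le`, `orthonormal_gramSchmidtNormed_of_gram`,
`inner_gramSchmidtNormed_self_pos`). The proof is the obvious strong induction along
`Fᵢ = gᵢ + ∑_{j<i} (⟪gⱼ, Fᵢ⟫/‖gⱼ‖²) gⱼ` (`gramSchmidt_def''`): `‖gⱼ‖ ≥ 1/2` and
`|⟪gⱼ, Fᵢ⟫| ≤ δ (1 + 2 Kⱼ)` give `‖gᵢ - Fᵢ‖ ≤ Kᵢ δ` with `Kᵢ = (8(n+1))ⁱ` (`norm_gramSchmidt_sub_le`).
Elementary (G. H. Golub, C. F. Van Loan, *Matrix Computations*, §5.2, perturbation of the QR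
factorisation, is the numerical-analysis form); recorded as the frame-level input of the comparison
of the `L²` metrics of nearby fibres in the semicontinuity of Hodge numbers
(`AlgebraicGeometry/Motives/FiberNetExistenceProofs`, Voisin I Prop. 9.20): an almost isometric
identification of tangent spaces carries an orthonormal frame to an almost orthonormal one, which
Gram–Schmidt corrects by a small amount.

Everything is proved; no definitions, no named facts. [folklore]
-/

noncomputable section

open Finset InnerProductSpace
open scoped RealInnerProductSpace

namespace Literature.Analysis.InnerProduct

variable {E : Type*} [NormedAddCommGroup E] [InnerProductSpace ℝ E] {n : ℕ}

/-- Norms of an almost orthonormal frame: `1 - δ ≤ ‖Fᵢ‖ ≤ 1 + δ` if `|‖Fᵢ‖² - 1| ≤ δ ≤ 1`.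
[folklore] -/
theorem norm_sub_one_le_of_inner_self {v : E} {δ : ℝ} (hδ0 : 0 ≤ δ)
    (h : |⟪v, v⟫ - 1| ≤ δ) : |‖v‖ - 1| ≤ δ := by
  rw [real_inner_self_eq_norm_sq] at h
  have hv : 0 ≤ ‖v‖ := norm_nonneg v
  rw [abs_le] at h ⊢
  constructor
  · -- `1 - δ ≤ ‖v‖` since `(1 - δ)² ≤ 1 - δ ≤ ‖v‖²`
    nlinarith [sq_nonneg (‖v‖ - (1 - δ)), sq_nonneg ‖v‖]
  · -- `‖v‖ ≤ 1 + δ` since `‖v‖² ≤ 1 + δ ≤ (1 + δ)²`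
    nlinarith [sq_nonneg (‖v‖ + (1 + δ))]

/-- **Gram–Schmidt on an almost orthonormal frame, unnormalised step.** If
`|⟪Fᵢ, Fⱼ⟫ - δᵢⱼ| ≤ δ` for all `i, j` and `δ (8(n+1))ⁿ ≤ 1/4`, then for every `i`,
`‖gᵢ - Fᵢ‖ ≤ (8(n+1))ⁱ δ` and `‖gᵢ‖ ≥ 1/2`, where `g = gramSchmidt ℝ F` (strong induction along
`gramSchmidt_def''`). [folklore] -/
theorem norm_gramSchmidt_sub_le {F : Fin n → E} {δ : ℝ} (hδ0 : 0 ≤ δ)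
    (hδ : δ * (8 * (n + 1)) ^ n ≤ 1 / 4)
    (hF : ∀ i j, |⟪F i, F j⟫ - (if i = j then 1 else 0)| ≤ δ) (i : Fin n) :
    ‖gramSchmidt ℝ F i - F i‖ ≤ (8 * (n + 1)) ^ (i : ℕ) * δ ∧ 1 / 2 ≤ ‖gramSchmidt ℝ F i‖ := by
  set A : ℝ := 8 * (n + 1) with hA
  have hA1 : 1 ≤ A := by rw [hA]; have : (0 : ℝ) ≤ n := n.cast_nonneg; linarith
  have hApow : ∀ k l : ℕ, k ≤ l → A ^ k ≤ A ^ l := fun k l hkl ↦ pow_le_pow_right₀ hA1 hkl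
  -- `δ ≤ 1/4` and `δ A^j ≤ 1/4` for `j ≤ n`
  have hδpow : ∀ k : ℕ, k ≤ n → δ * A ^ k ≤ 1 / 4 := fun k hk ↦
    (mul_le_mul_of_nonneg_left (hApow k n hk) hδ0).trans hδ
  have hδ4 : δ ≤ 1 / 4 := by simpa using hδpow 0 (Nat.zero_le n)
  have hδ1 : δ ≤ 1 := by linarith
  -- norms of the `F i`
  have hFnorm : ∀ i, |‖F i‖ - 1| ≤ δ := fun i ↦
    norm_sub_one_le_of_inner_self hδ0 (by simpa using hF i i)
  have hFle : ∀ i, ‖F i‖ ≤ 2 := fun i ↦ by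
    have := (abs_le.1 (hFnorm i)).2; linarith
  have hFge : ∀ i, 1 - δ ≤ ‖F i‖ := fun i ↦ by
    have := (abs_le.1 (hFnorm i)).1; linarith
  -- strong induction on `i`
  induction i using Fin.strong_induction_on with
  | h i ih =>
    -- the bound on each subtracted term
    have hterm : ∀ j ∈ Iio i,
        ‖(⟪gramSchmidt ℝ F j, F i⟫ / ‖gramSchmidt ℝ F j‖ ^ 2) • gramSchmidt ℝ F j‖ ≤
          2 * δ * (1 + 2 * A ^ (j : ℕ)) := by
      intro j hj
      have hji : j < i := mem_Iio.1 hj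
      obtain ⟨hj1, hj2⟩ := ih j hji
      have hgpos : 0 < ‖gramSchmidt ℝ F j‖ := by linarith
      -- `|⟪g j, F i⟫| ≤ δ + A^j δ ‖F i‖ ≤ δ (1 + 2 A^j)`
      have hinner : |⟪gramSchmidt ℝ F j, F i⟫| ≤ δ * (1 + 2 * A ^ (j : ℕ)) := by
        have h1 : ⟪gramSchmidt ℝ F j, F i⟫ = ⟪F j, F i⟫ + ⟪gramSchmidt ℝ F j - F j, F i⟫ := by
          rw [inner_sub_left]; ring
        have h2 : |⟪F j, F i⟫| ≤ δ := by simpa [hji.ne] using hF j i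
        have h3 : |⟪gramSchmidt ℝ F j - F j, F i⟫| ≤ A ^ (j : ℕ) * δ * 2 :=
          (abs_real_inner_le_norm _ _).trans (mul_le_mul hj1 (hFle i) (norm_nonneg _)
            (by positivity))
        rw [h1]
        calc |⟪F j, F i⟫ + ⟪gramSchmidt ℝ F j - F j, F i⟫|
            ≤ |⟪F j, F i⟫| + |⟪gramSchmidt ℝ F j - F j, F i⟫| := abs_add_le _ _
          _ ≤ δ + A ^ (j : ℕ) * δ * 2 := add_le_add h2 h3
          _ = δ * (1 + 2 * A ^ (j : ℕ)) := by ring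
      have hg0 : ‖gramSchmidt ℝ F j‖ ≠ 0 := hgpos.ne'
      have hc : ‖(⟪gramSchmidt ℝ F j, F i⟫ / ‖gramSchmidt ℝ F j‖ ^ 2) • gramSchmidt ℝ F j‖ =
          |⟪gramSchmidt ℝ F j, F i⟫| / ‖gramSchmidt ℝ F j‖ := by
        rw [norm_smul, Real.norm_eq_abs, abs_div, abs_pow, abs_norm]
        field_simp
      rw [hc, div_le_iff₀ hgpos]
      calc |⟪gramSchmidt ℝ F j, F i⟫| ≤ δ * (1 + 2 * A ^ (j : ℕ)) := hinner
        _ ≤ 2 * δ * (1 + 2 * A ^ (j : ℕ)) * ‖gramSchmidt ℝ F j‖ := by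
          have h0 : 0 ≤ δ * (1 + 2 * A ^ (j : ℕ)) := by positivity
          nlinarith
    -- sum of the terms
    have hsum : ‖gramSchmidt ℝ F i - F i‖ ≤ A ^ (i : ℕ) * δ := by
      have hdef := gramSchmidt_def'' ℝ F i
      have heq : gramSchmidt ℝ F i - F i =
          -∑ j ∈ Iio i, (⟪gramSchmidt ℝ F j, F i⟫ / ‖gramSchmidt ℝ F j‖ ^ 2) • gramSchmidt ℝ F j := by
        have : (∑ j ∈ Iio i, (⟪gramSchmidt ℝ F j, F i⟫ / (‖gramSchmidt ℝ F j‖ : ℝ) ^ 2) •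
            gramSchmidt ℝ F j) = F i - gramSchmidt ℝ F i := by
          rw [eq_sub_iff_add_eq, add_comm]; exact hdef.symm
        rw [this]; abel
      rw [heq, norm_neg]
      by_cases hi0 : (i : ℕ) = 0
      · have : Iio i = ∅ := by
          ext j; simp only [mem_Iio, Finset.notMem_empty, iff_false, not_lt]
          exact Fin.le_def.2 (by omega)
        rw [this, sum_empty, norm_zero]; positivity
      calc ‖∑ j ∈ Iio i, (⟪gramSchmidt ℝ F j, F i⟫ / ‖gramSchmidt ℝ F j‖ ^ 2) • gramSchmidt ℝ F j‖
          ≤ ∑ j ∈ Iio i, ‖(⟪gramSchmidt ℝ F j, F i⟫ / ‖gramSchmidt ℝ F j‖ ^ 2) • gramSchmidt ℝ F j‖ :=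
            norm_sum_le _ _
        _ ≤ ∑ j ∈ Iio i, 2 * δ * (1 + 2 * A ^ ((i : ℕ) - 1)) := by
            refine sum_le_sum fun j hj ↦ (hterm j hj).trans ?_
            have hji : (j : ℕ) ≤ (i : ℕ) - 1 := by
              have := mem_Iio.1 hj; rw [Fin.lt_def] at this; omega
            have := hApow _ _ hji
            nlinarith
        _ = (i : ℕ) * (2 * δ * (1 + 2 * A ^ ((i : ℕ) - 1))) := by
            rw [sum_const, Fin.card_Iio, nsmul_eq_mul]
        _ ≤ A ^ (i : ℕ) * δ := by
            -- `i ≤ n`, `6 n A^{i-1} ≤ A^i`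
            have hin : ((i : ℕ) : ℝ) ≤ n := by exact_mod_cast i.is_lt.le
            have hn0 : (0 : ℝ) ≤ n := n.cast_nonneg
            have hApos : 0 < A ^ ((i : ℕ) - 1) := by positivity
            have h1A : 1 ≤ A ^ ((i : ℕ) - 1) := one_le_pow₀ hA1
            have hpow : A ^ (i : ℕ) = A * A ^ ((i : ℕ) - 1) := by
              rw [← pow_succ']; congr 1; omega
            rw [hpow, hA]
            nlinarith [mul_nonneg hδ0 hApos.le, mul_nonneg hn0 hδ0,
              mul_nonneg (mul_nonneg hn0 hδ0) hApos.le]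
    refine ⟨hsum, ?_⟩
    -- `‖g i‖ ≥ ‖F i‖ - ‖g i - F i‖ ≥ (1 - δ) - 1/4 ≥ 1/2`
    have h1 : ‖F i‖ - ‖gramSchmidt ℝ F i - F i‖ ≤ ‖gramSchmidt ℝ F i‖ := by
      have := norm_sub_norm_le (F i) (F i - gramSchmidt ℝ F i)
      rw [sub_sub_cancel, norm_sub_rev] at this
      linarith
    have h2 : A ^ (i : ℕ) * δ ≤ 1 / 4 := by rw [mul_comm]; exact hδpow _ i.is_lt.le
    linarith [hFge i]

/-- **Gram–Schmidt on an almost orthonormal frame moves it little**: under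
`|⟪Fᵢ, Fⱼ⟫ - δᵢⱼ| ≤ δ`, `δ (8(n+1))ⁿ ≤ 1/4`, the orthonormalised frame satisfies
`‖gramSchmidtNormed ℝ F i - F i‖ ≤ 3 (8(n+1))ⁿ δ` for every `i`. [folklore] -/
theorem gramSchmidtNormed_sub_le {F : Fin n → E} {δ : ℝ} (hδ0 : 0 ≤ δ)
    (hδ : δ * (8 * (n + 1)) ^ n ≤ 1 / 4)
    (hF : ∀ i j, |⟪F i, F j⟫ - (if i = j then 1 else 0)| ≤ δ) (i : Fin n) :
    ‖gramSchmidtNormed ℝ F i - F i‖ ≤ 3 * (8 * (n + 1)) ^ n * δ := by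
  obtain ⟨h1, h2⟩ := norm_gramSchmidt_sub_le hδ0 hδ hF i
  set A : ℝ := 8 * (n + 1) with hA
  have hA1 : 1 ≤ A := by rw [hA]; have : (0 : ℝ) ≤ n := n.cast_nonneg; linarith
  have hAi : A ^ (i : ℕ) ≤ A ^ n := pow_le_pow_right₀ hA1 i.is_lt.le
  have hδ1 : δ ≤ 1 := by
    have : δ * A ^ n ≤ 1 / 4 := hδ
    have h1A : 1 ≤ A ^ n := one_le_pow₀ hA1
    nlinarith
  have hgpos : 0 < ‖gramSchmidt ℝ F i‖ := by linarith
  -- `gsn i - F i = (g i / ‖g i‖ - g i) + (g i - F i)` and `‖g i/‖g i‖ - g i‖ = |1 - ‖g i‖|`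
  have hnormF : |‖F i‖ - 1| ≤ δ := norm_sub_one_le_of_inner_self hδ0 (by simpa using hF i i)
  have hdecomp : gramSchmidtNormed ℝ F i - F i =
      ((‖gramSchmidt ℝ F i‖)⁻¹ • gramSchmidt ℝ F i - gramSchmidt ℝ F i) +
        (gramSchmidt ℝ F i - F i) := by
    rw [gramSchmidtNormed]; simp only [RCLike.ofReal_real_eq_id, id_eq]; abel
  have hfirst : ‖(‖gramSchmidt ℝ F i‖)⁻¹ • gramSchmidt ℝ F i - gramSchmidt ℝ F i‖ =
      |1 - ‖gramSchmidt ℝ F i‖| := by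
    have : (‖gramSchmidt ℝ F i‖)⁻¹ • gramSchmidt ℝ F i - gramSchmidt ℝ F i =
        ((‖gramSchmidt ℝ F i‖)⁻¹ - 1) • gramSchmidt ℝ F i := by rw [sub_smul, one_smul]
    rw [this, norm_smul, Real.norm_eq_abs]
    rw [show (‖gramSchmidt ℝ F i‖)⁻¹ - 1 = (1 - ‖gramSchmidt ℝ F i‖) / ‖gramSchmidt ℝ F i‖ by
      field_simp]
    rw [abs_div, abs_of_pos hgpos, div_mul_cancel₀ _ hgpos.ne']
  have hg1 : |1 - ‖gramSchmidt ℝ F i‖| ≤ δ + A ^ (i : ℕ) * δ := by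
    have := norm_sub_norm_le (gramSchmidt ℝ F i) (F i)
    have h' := abs_norm_sub_norm_le (gramSchmidt ℝ F i) (F i)
    rw [abs_sub_comm] at hnormF
    calc |1 - ‖gramSchmidt ℝ F i‖| ≤ |1 - ‖F i‖| + |‖F i‖ - ‖gramSchmidt ℝ F i‖| := abs_sub_le _ _ _
      _ ≤ δ + A ^ (i : ℕ) * δ := add_le_add hnormF (by rw [abs_sub_comm]; exact h'.trans h1)
  calc ‖gramSchmidtNormed ℝ F i - F i‖
      ≤ ‖(‖gramSchmidt ℝ F i‖)⁻¹ • gramSchmidt ℝ F i - gramSchmidt ℝ F i‖ +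
          ‖gramSchmidt ℝ F i - F i‖ := by rw [hdecomp]; exact norm_add_le _ _
    _ ≤ (δ + A ^ (i : ℕ) * δ) + A ^ (i : ℕ) * δ := by rw [hfirst]; exact add_le_add hg1 h1
    _ ≤ 3 * A ^ n * δ := by
        have h1A : 1 ≤ A ^ n := one_le_pow₀ hA1
        nlinarith [mul_le_mul_of_nonneg_right hAi hδ0]

/-- Under the same hypotheses the Gram–Schmidt vectors are all non-zero, so the orthonormalised
frame IS orthonormal (Mathlib's `gramSchmidt_orthogonal`, `gramSchmidtNormed_unit_length'`).
[folklore] -/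
theorem orthonormal_gramSchmidtNormed_of_gram {F : Fin n → E} {δ : ℝ} (hδ0 : 0 ≤ δ)
    (hδ : δ * (8 * (n + 1)) ^ n ≤ 1 / 4)
    (hF : ∀ i j, |⟪F i, F j⟫ - (if i = j then 1 else 0)| ≤ δ) :
    Orthonormal ℝ (gramSchmidtNormed ℝ F) := by
  have hne : ∀ i, gramSchmidtNormed ℝ F i ≠ 0 := by
    intro i h0
    have h2 := (norm_gramSchmidt_sub_le hδ0 hδ hF i).2
    have : gramSchmidt ℝ F i = 0 := by
      rw [gramSchmidtNormed, smul_eq_zero] at h0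
      rcases h0 with h0 | h0
      · simp only [RCLike.ofReal_real_eq_id, id_eq, inv_eq_zero, norm_eq_zero] at h0; exact h0
      · exact h0
    rw [this, norm_zero] at h2; linarith
  rw [orthonormal_iff_ite]
  intro i j
  by_cases hij : i = j
  · subst hij
    rw [if_pos rfl, real_inner_self_eq_norm_sq, gramSchmidtNormed_unit_length' (hne i), one_pow]
  · rw [if_neg hij, gramSchmidtNormed, gramSchmidtNormed, inner_smul_left, inner_smul_right,
      gramSchmidt_orthogonal ℝ F hij, mul_zero, mul_zero]

/-- Under the same hypotheses `⟪gramSchmidtNormed ℝ F i, F i⟫ ≥ 1 - 3 (8(n+1))ⁿ δ`, in particular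
it is positive as soon as `3 (8(n+1))ⁿ δ < 1` (so the orthonormalised frame induces the same
orientation as `F`, by `gramSchmidtOrthonormalBasis_det`). [folklore] -/
theorem inner_gramSchmidtNormed_self_ge {F : Fin n → E} {δ : ℝ} (hδ0 : 0 ≤ δ)
    (hδ : δ * (8 * (n + 1)) ^ n ≤ 1 / 4)
    (hF : ∀ i j, |⟪F i, F j⟫ - (if i = j then 1 else 0)| ≤ δ) (i : Fin n) :
    1 - 3 * (8 * (n + 1)) ^ n * δ ≤ ⟪gramSchmidtNormed ℝ F i, F i⟫ := by
  have hon := orthonormal_gramSchmidtNormed_of_gram hδ0 hδ hF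
  have h1 : ‖gramSchmidtNormed ℝ F i‖ = 1 := hon.norm_eq_one i
  have hsub := gramSchmidtNormed_sub_le hδ0 hδ hF i
  -- `⟪b, F⟫ = ⟪b, b⟫ - ⟪b, b - F⟫ ≥ 1 - ‖b - F‖`
  have heq : ⟪gramSchmidtNormed ℝ F i, F i⟫ =
      ⟪gramSchmidtNormed ℝ F i, gramSchmidtNormed ℝ F i⟫ -
        ⟪gramSchmidtNormed ℝ F i, gramSchmidtNormed ℝ F i - F i⟫ := by
    rw [inner_sub_right]; ring
  rw [heq, real_inner_self_eq_norm_sq, h1, one_pow]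
  have := abs_real_inner_le_norm (gramSchmidtNormed ℝ F i) (gramSchmidtNormed ℝ F i - F i)
  rw [h1, one_mul] at this
  have := (abs_le.1 this).2
  linarith

end Literature.Analysis.InnerProduct
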